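import Summits.AtomisticToContinuum.Crystallization.Theses.PhononSlackCertificates
import Summits.AtomisticToContinuum.Crystallization.Theorems.PhononSlackCertificatesWindowOptimalityCut
import Summits.AtomisticToContinuum.Crystallization.Theorems.PhononSlackCertificatesWindowOptimalityMatch
import Literature.MathematicalPhysics.StatisticalMechanics.LocalLimitOfGroundStates

/-!
# `PeriodicGivenLayered` (stmt-AtomisticToContinuum-11779), line `Sketch`: window bounds II

Helper file for stub `stub_windowBounds` of the line (lead skeleton `PeriodicGivenLayered`): the
FINITE-`N` CUT-AND-PASTE step of the upper bound (U), for an arbitrary point set `S ⊆ ℝ³` (the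
periodic case is `PhononSlackCertificatesWindowOptimalityMatch`, whose lemmas are re-proved here
with `P.points` replaced by `S`).

Setting: a translate `y` of a Lennard-Jones ground state (`δ`-separated) is two-way `ε`-matched with
the `δ`-separated set `S` on the ball `‖·‖ ≤ R`; `π s` is a particle within `ε` of the point `s`
(`‖s‖ ≤ R`).  For `2ε < δ` the matching is unique, injective and onto the particles of norm
`≤ R − ε` (`wb_eq_pi_of_dist_le`, `wb_pi_inj`, `wb_exists_pi_eq`).  Consequences:

* `wb_near_sub_le_siteEnergy` (S1): `𝓔^{π p}(y) ≥ Σ_{q ∈ F} V_LJ(|p − q|) − ω·#F − τ(L)` for the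
  finite set `F` of points of `S` within `L` of `p`, a modulus `ω` of `V_LJ` at the distances
  `|p − q|`, and the tail `τ(L) = (1/6)·1024/(δ³(L/2)³)`;
* `wb_cross_ge`: for a finite `W ⊆ S` and `p ∈ W`, the cross terms of `π p` with the particles NOT
  matched to `W` are `≥ −C(δ) (1 + dist(p, S ∖ W))⁻³`, `C(δ) = (1024/(6δ³))(1 + 3/(2δ))³`: an
  unmatched particle is either matched to a point of `S ∖ W` or outside the ball;
* `wb_finiteN`: with the cut inequality `cut_lt` (strict binding), the particles matched to `W`
  carry site energy `Σ_{p ∈ W} 𝓔^{π p}(y) < 2 E(#W) + C(δ) Σ_{p ∈ W} (1 + dist(p, S ∖ W))⁻³`;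
* `wb_sep_of_hull`: a set in the hull of a sequence of `δ`-separated ground states (two-way matched
  at every scale, frequently in `N`) is `δ`-separated.

All `[folklore]`; nothing here closes the item.
-/

noncomputable section

namespace Summit.AtomisticToContinuum.Crystallization.Theorems.LayeredHull

open scoped BigOperators
open Filter Literature.MathematicalPhysics.StatisticalMechanics
open Summit.AtomisticToContinuum.Crystallization.Theorems.PhononSlackWindowOptimality
  (cut_lt neg_le_sum_lennardJones_of_far norm_le_norm_add_dist)

section Matching

variable {S : Set (EuclideanSpace ℝ (Fin 3))} {N : ℕ} {y : Fin N → EuclideanSpace ℝ (Fin 3)}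
  {δ ε R : ℝ} {π : EuclideanSpace ℝ (Fin 3) → Fin N}

/-- **Uniqueness of the matched particle**: a particle within `ε` of a point `s ∈ S` (`‖s‖ ≤ R`)
is `π s`, since two such particles would be `2ε < δ` apart. [folklore] -/
theorem wb_eq_pi_of_dist_le (hsep : ∀ i j, i ≠ j → δ ≤ dist (y i) (y j)) (hεδ : 2 * ε < δ)
    (hπ : ∀ s ∈ S, ‖s‖ ≤ R → dist (y (π s)) s ≤ ε)
    {s : EuclideanSpace ℝ (Fin 3)} (hs : s ∈ S) (hsR : ‖s‖ ≤ R) {j : Fin N}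
    (hj : dist (y j) s ≤ ε) : j = π s := by
  by_contra hne
  have h := hsep j (π s) hne
  have h' : dist (y j) (y (π s)) ≤ dist (y j) s + dist (y (π s)) s := dist_triangle_right _ _ _
  linarith [hπ s hs hsR]

/-- **Injectivity of the matching on points**: two points of `S` of norm `≤ R` with the same
matched particle coincide, since they would be `2ε < δ` apart. [folklore] -/
theorem wb_pi_inj (hS : ∀ p ∈ S, ∀ q ∈ S, p ≠ q → δ ≤ dist p q) (hεδ : 2 * ε < δ)
    (hπ : ∀ s ∈ S, ‖s‖ ≤ R → dist (y (π s)) s ≤ ε)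
    {s s' : EuclideanSpace ℝ (Fin 3)} (hs : s ∈ S) (hs' : s' ∈ S) (hsR : ‖s‖ ≤ R)
    (hs'R : ‖s'‖ ≤ R) (h : π s = π s') : s = s' := by
  by_contra hne
  have h1 := hS s hs s' hs' hne
  have a := hπ s hs hsR
  have b := hπ s' hs' hs'R
  rw [h] at a
  have h2 : dist s s' ≤ dist (y (π s')) s + dist (y (π s')) s' := dist_triangle_left _ _ _
  linarith

/-- **The matching is onto the deep particles**: a particle of norm `≤ R − ε` is `π s` for a
point `s ∈ S` of norm `≤ R` within `ε` of it. [folklore] -/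
theorem wb_exists_pi_eq (hsep : ∀ i j, i ≠ j → δ ≤ dist (y i) (y j)) (hεδ : 2 * ε < δ)
    (hπ : ∀ s ∈ S, ‖s‖ ≤ R → dist (y (π s)) s ≤ ε)
    (hfit : ∀ i, ‖y i‖ ≤ R → ∃ s ∈ S, dist (y i) s ≤ ε) (hε : 0 ≤ ε)
    {i : Fin N} (hi : ‖y i‖ ≤ R - ε) :
    ∃ s ∈ S, ‖s‖ ≤ R ∧ π s = i ∧ dist (y i) s ≤ ε := by
  obtain ⟨s, hs, hd⟩ := hfit i (by linarith)
  have hsR : ‖s‖ ≤ R := by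
    have := norm_le_norm_add_dist s (y i)
    linarith
  exact ⟨s, hs, hsR, (wb_eq_pi_of_dist_le hsep hεδ hπ hs hsR hd).symm, hd⟩

/-- Matched particles reproduce the distances of their points up to `2ε`. [folklore] -/
theorem wb_abs_dist_pi_sub_le (hπ : ∀ s ∈ S, ‖s‖ ≤ R → dist (y (π s)) s ≤ ε)
    {s s' : EuclideanSpace ℝ (Fin 3)} (hs : s ∈ S) (hsR : ‖s‖ ≤ R) (hs' : s' ∈ S)
    (hs'R : ‖s'‖ ≤ R) : |dist (y (π s)) (y (π s')) - dist s s'| ≤ 2 * ε := by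
  have a := hπ s hs hsR
  have b := hπ s' hs' hs'R
  rw [abs_le]
  constructor
  · have := dist_triangle4 s (y (π s)) (y (π s')) s'
    rw [dist_comm s (y (π s))] at this
    linarith
  · have := dist_triangle4 (y (π s)) s s' (y (π s'))
    rw [dist_comm s' (y (π s'))] at this
    linarith

/-- Points within `L` of a point `p` with `‖p‖ + L ≤ R − ε` have norm `≤ R`. [folklore] -/
theorem wb_norm_le_of_near {L : ℝ} {p : EuclideanSpace ℝ (Fin 3)} (hpR : ‖p‖ + L ≤ R - ε)
    (hε : 0 ≤ ε) {F : Finset {q // q ∈ S ∧ q ≠ p}} (hF : ∀ q, q ∈ F ↔ dist p q.1 < L)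
    {q : {q // q ∈ S ∧ q ≠ p}} (hq : q ∈ F) : ‖q.1‖ ≤ R := by
  have h1 := (hF q).1 hq
  have h2 := norm_le_norm_add_dist q.1 p
  linarith

/-- **Unmatched particles are far.** With `p ∈ S`, `‖p‖ + L ≤ R − ε`, `4ε ≤ L`, and `F` the points
within `L` of `p`: a particle `j ≠ π p` which is not `π q` for any `q ∈ F` is at distance `≥ L/2`
from the particle `π p` (otherwise it is deep, hence matched to a point, which lies within `L` of
`p`). [folklore] -/
theorem wb_le_dist_of_not_mem_image
    (hsep : ∀ i j, i ≠ j → δ ≤ dist (y i) (y j)) (hεδ : 2 * ε < δ) (hε : 0 ≤ ε)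
    (hπ : ∀ s ∈ S, ‖s‖ ≤ R → dist (y (π s)) s ≤ ε)
    (hfit : ∀ i, ‖y i‖ ≤ R → ∃ s ∈ S, dist (y i) s ≤ ε)
    {L : ℝ} (hεL : 4 * ε ≤ L) {p : EuclideanSpace ℝ (Fin 3)} (hp : p ∈ S) (hpR : ‖p‖ + L ≤ R - ε)
    (F : Finset {q // q ∈ S ∧ q ≠ p}) (hF : ∀ q, q ∈ F ↔ dist p q.1 < L)
    {j : Fin N} (hji : j ≠ π p) (hjA : j ∉ F.image fun q => π q.1) :
    L / 2 ≤ dist (y (π p)) (y j) := by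
  have hpR' : ‖p‖ ≤ R := by linarith
  by_contra hlt
  rw [not_le] at hlt
  have hyp : dist (y (π p)) p ≤ ε := hπ p hp hpR'
  have hyi : ‖y (π p)‖ ≤ ‖p‖ + ε := by
    have := norm_le_norm_add_dist (y (π p)) p
    rw [dist_comm] at this
    linarith
  have hyj : ‖y j‖ ≤ R - ε := by
    have := norm_le_norm_add_dist (y j) (y (π p))
    linarith
  obtain ⟨s, hs, -, hπs, hds⟩ := wb_exists_pi_eq hsep hεδ hπ hfit hε hyj
  have hsp : s ≠ p := fun h => hji (by rw [← hπs, h])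
  have hdist : dist p s < L :=
    calc dist p s ≤ dist p (y (π p)) + dist (y (π p)) (y j) + dist (y j) s := dist_triangle4 _ _ _ _
      _ < ε + L / 2 + ε := by rw [dist_comm p]; linarith
      _ ≤ L := by linarith
  have hmem : (⟨s, hs, hsp⟩ : {q // q ∈ S ∧ q ≠ p}) ∈ F := (hF _).2 hdist
  exact hjA (Finset.mem_image.2 ⟨_, hmem, hπs⟩)

/-- **(S1) Site energies of matched particles are nearly the near sums.** For a point `p ∈ S`
with `‖p‖ + L ≤ R − ε`, `F` the points of `S` within `L` of `p`, and `ω` a modulus of `V_LJ`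
valid at the distances `|p − q|`, `q ∈ F`, for perturbations `≤ 2ε`:
`Σ_{q ∈ F} V_LJ(|p − q|) − ω·#F − (1/6)·1024/(δ³(L/2)³) ≤ 𝓔^{π p}(y)`. [folklore] -/
theorem wb_near_sub_le_siteEnergy (hδ : 0 < δ)
    (hsep : ∀ i j, i ≠ j → δ ≤ dist (y i) (y j))
    (hS : ∀ p ∈ S, ∀ q ∈ S, p ≠ q → δ ≤ dist p q)
    (hεδ : 2 * ε < δ) (hε : 0 ≤ ε)
    (hπ : ∀ s ∈ S, ‖s‖ ≤ R → dist (y (π s)) s ≤ ε)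
    (hfit : ∀ i, ‖y i‖ ≤ R → ∃ s ∈ S, dist (y i) s ≤ ε)
    {L : ℝ} (hδL : δ ≤ L / 2) (hεL : 4 * ε ≤ L)
    {p : EuclideanSpace ℝ (Fin 3)} (hp : p ∈ S) (hpR : ‖p‖ + L ≤ R - ε)
    (F : Finset {q // q ∈ S ∧ q ≠ p}) (hF : ∀ q, q ∈ F ↔ dist p q.1 < L)
    {ω : ℝ} (hω : ∀ q ∈ F, ∀ r : ℝ, |r - dist p q.1| ≤ 2 * ε →
      lennardJones (dist p q.1) - ω ≤ lennardJones r) :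
    ∑ q ∈ F, lennardJones (dist p q.1) - ω * F.card - 1 / 6 * (1024 / (δ ^ 3 * (L / 2) ^ 3)) ≤
      siteEnergy lennardJones y (π p) := by
  classical
  have hpR' : ‖p‖ ≤ R := by linarith
  have hqR : ∀ q ∈ F, ‖q.1‖ ≤ R := fun q hq => wb_norm_le_of_near hpR hε hF hq
  have hinjF : ∀ q ∈ F, ∀ q' ∈ F, π q.1 = π q'.1 → q = q' := fun q hq q' hq' h =>
    Subtype.ext (wb_pi_inj hS hεδ hπ q.2.1 q'.2.1 (hqR q hq) (hqR q' hq') h)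
  have hAsub : (F.image fun q => π q.1) ⊆ Finset.univ.erase (π p) := by
    intro j hj
    obtain ⟨q, hq, rfl⟩ := Finset.mem_image.1 hj
    refine Finset.mem_erase.2 ⟨fun h => q.2.2 ?_, Finset.mem_univ _⟩
    exact wb_pi_inj hS hεδ hπ q.2.1 hp (hqR q hq) hpR' h
  unfold siteEnergy
  rw [← Finset.sum_sdiff hAsub, Finset.sum_image hinjF]
  have hA_ge : ∑ q ∈ F, (lennardJones (dist p q.1) - ω) ≤
      ∑ q ∈ F, lennardJones (dist (y (π p)) (y (π q.1))) :=
    Finset.sum_le_sum fun q hq => hω q hq _ (wb_abs_dist_pi_sub_le hπ hp hpR' q.2.1 (hqR q hq))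
  have hfar : ∀ j ∈ Finset.univ.erase (π p) \ F.image (fun q => π q.1),
      L / 2 ≤ dist (y (π p)) (y j) := by
    intro j hj
    rw [Finset.mem_sdiff, Finset.mem_erase] at hj
    exact wb_le_dist_of_not_mem_image hsep hεδ hε hπ hfit hεL hp hpR F hF hj.1.1 hj.2
  have htail := neg_le_sum_lennardJones_of_far hδ hδL hsep (π p) _ hfar
  have hcard : ∑ q ∈ F, (lennardJones (dist p q.1) - ω) =
      ∑ q ∈ F, lennardJones (dist p q.1) - ω * F.card := by
    rw [Finset.sum_sub_distrib, Finset.sum_const, nsmul_eq_mul]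
    ring
  linarith

/-- **Cross terms of a matched particle.** For a finite `W ⊆ S`, `p ∈ W` with
`‖p‖ + dist(p, S ∖ W) ≤ R − 2ε` and `ε ≤ 1/4`: the interaction of `π p` with the particles not
matched to `W` is `≥ −(1024/(6δ³))(1 + 3/(2δ))³ (1 + dist(p, S ∖ W))⁻³`.  Such a particle `j` is
either deep — then `j = π s` with `s ∈ S ∖ W`, so `|y_{π p} − y_j| ≥ dist(p, S ∖ W) − 2ε` — or of
norm `> R − ε`, hence also that far; and it is `δ`-far anyway; then the `r⁻⁶` tail
`neg_le_sum_lennardJones_of_far`. [folklore] -/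
theorem wb_cross_ge (hδ : 0 < δ) (hsep : ∀ i j, i ≠ j → δ ≤ dist (y i) (y j))
    (hεδ : 2 * ε < δ) (hε : 0 ≤ ε) (hε4 : ε ≤ 1 / 4)
    (hπ : ∀ s ∈ S, ‖s‖ ≤ R → dist (y (π s)) s ≤ ε)
    (hfit : ∀ i, ‖y i‖ ≤ R → ∃ s ∈ S, dist (y i) s ≤ ε)
    {W : Finset (EuclideanSpace ℝ (Fin 3))} (hWS : (↑W : Set (EuclideanSpace ℝ (Fin 3))) ⊆ S)
    {p : EuclideanSpace ℝ (Fin 3)} (hp : p ∈ W)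
    (hpR : ‖p‖ + Metric.infDist p (S \ (↑W : Set (EuclideanSpace ℝ (Fin 3)))) ≤ R - 2 * ε) :
    -(1024 / (6 * δ ^ 3) * (1 + 3 / (2 * δ)) ^ 3 *
        (1 + Metric.infDist p (S \ (↑W : Set (EuclideanSpace ℝ (Fin 3)))))⁻¹ ^ 3) ≤
      ∑ j ∈ (W.image π)ᶜ, lennardJones (dist (y (π p)) (y j)) := by
  classical
  set r := Metric.infDist p (S \ (↑W : Set (EuclideanSpace ℝ (Fin 3)))) with hr
  have hr0 : 0 ≤ r := Metric.infDist_nonneg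
  have hpS : p ∈ S := hWS hp
  have hpR' : ‖p‖ ≤ R := by linarith
  set ρ := max δ (r - 2 * ε) with hρdef
  have hδρ : δ ≤ ρ := le_max_left _ _
  have hρ0 : 0 < ρ := hδ.trans_le hδρ
  have hyp : dist (y (π p)) p ≤ ε := hπ p hpS hpR'
  have hfar : ∀ j ∈ (W.image π)ᶜ, ρ ≤ dist (y (π p)) (y j) := by
    intro j hj
    rw [Finset.mem_compl, Finset.mem_image, not_exists] at hj
    have hji : j ≠ π p := fun h => hj p ⟨hp, h.symm⟩
    refine max_le (hsep _ _ (Ne.symm hji)) ?_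
    by_cases hjR : ‖y j‖ ≤ R - ε
    · obtain ⟨s, hs, -, hπs, hds⟩ := wb_exists_pi_eq hsep hεδ hπ hfit hε hjR
      have hsW : s ∉ W := fun hsW => hj s ⟨hsW, hπs⟩
      have hrs : r ≤ dist p s := Metric.infDist_le_dist_of_mem ⟨hs, hsW⟩
      have := dist_triangle4 p (y (π p)) (y j) s
      rw [dist_comm p (y (π p))] at this
      linarith
    · rw [not_le] at hjR
      have h1 := norm_le_norm_add_dist (y j) (y (π p))
      have h2 : ‖y (π p)‖ ≤ ‖p‖ + ε := by
        have := norm_le_norm_add_dist (y (π p)) p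
        rw [dist_comm] at this
        linarith
      linarith
  have htail := neg_le_sum_lennardJones_of_far hδ hδρ hsep (π p) _ hfar
  have hkey : 1 / 6 * (1024 / (δ ^ 3 * ρ ^ 3)) ≤
      1024 / (6 * δ ^ 3) * (1 + 3 / (2 * δ)) ^ 3 * (1 + r)⁻¹ ^ 3 := by
    have h1r : 0 < 1 + r := by linarith
    have hle : 1 + r ≤ (1 + 3 / (2 * δ)) * ρ := by
      have hrρ : r - 2 * ε ≤ ρ := le_max_right _ _
      have h32 : 3 / 2 ≤ 3 / (2 * δ) * ρ := by
        rw [div_mul_eq_mul_div, le_div_iff₀ (by positivity)]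
        nlinarith
      nlinarith
    have h3 : (1 + r) ^ 3 ≤ ((1 + 3 / (2 * δ)) * ρ) ^ 3 := pow_le_pow_left₀ h1r.le hle 3
    have hfrac : 1 / ρ ^ 3 ≤ (1 + 3 / (2 * δ)) ^ 3 / (1 + r) ^ 3 := by
      rw [div_le_div_iff₀ (by positivity) (by positivity), one_mul, ← mul_pow]
      exact h3
    calc 1 / 6 * (1024 / (δ ^ 3 * ρ ^ 3)) = 1024 / (6 * δ ^ 3) * (1 / ρ ^ 3) := by
          field_simp
      _ ≤ 1024 / (6 * δ ^ 3) * ((1 + 3 / (2 * δ)) ^ 3 / (1 + r) ^ 3) :=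
          mul_le_mul_of_nonneg_left hfrac (by positivity)
      _ = 1024 / (6 * δ ^ 3) * (1 + 3 / (2 * δ)) ^ 3 * (1 + r)⁻¹ ^ 3 := by
          rw [inv_pow]
          ring
  linarith

/-- **The finite-`N` cut.** Under the matching hypotheses, for a finite non-empty `W ⊆ S` with
`#W < N` and `‖p‖ + dist(p, S ∖ W) ≤ R − 2ε` on `W`, the particles matched to `W` carry site energy
`Σ_{p ∈ W} 𝓔^{π p}(y) < 2 E(#W) + (1024/(6δ³))(1 + 3/(2δ))³ Σ_{p ∈ W} (1 + dist(p, S ∖ W))⁻³`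
(the cut inequality `cut_lt` for the matched set `π(W)`, of cardinality `#W` by injectivity, minus
the cross terms bounded by `wb_cross_ge`). [folklore] -/
theorem wb_finiteN (hδ : 0 < δ) (hsep : ∀ i j, i ≠ j → δ ≤ dist (y i) (y j))
    (hS : ∀ p ∈ S, ∀ q ∈ S, p ≠ q → δ ≤ dist p q) (hεδ : 2 * ε < δ) (hε : 0 ≤ ε)
    (hε4 : ε ≤ 1 / 4) (hπ : ∀ s ∈ S, ‖s‖ ≤ R → dist (y (π s)) s ≤ ε)
    (hfit : ∀ i, ‖y i‖ ≤ R → ∃ s ∈ S, dist (y i) s ≤ ε) (hyg : IsGroundState lennardJones y)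
    {W : Finset (EuclideanSpace ℝ (Fin 3))} (hWS : (↑W : Set (EuclideanSpace ℝ (Fin 3))) ⊆ S)
    (hWne : W.Nonempty) (hNW : W.card < N)
    (hWR : ∀ p ∈ W,
      ‖p‖ + Metric.infDist p (S \ (↑W : Set (EuclideanSpace ℝ (Fin 3)))) ≤ R - 2 * ε) :
    ∑ p ∈ W, siteEnergy lennardJones y (π p) <
      2 * groundStateEnergy lennardJones 3 W.card +
        1024 / (6 * δ ^ 3) * (1 + 3 / (2 * δ)) ^ 3 *
          ∑ p ∈ W, (1 + Metric.infDist p (S \ (↑W : Set (EuclideanSpace ℝ (Fin 3)))))⁻¹ ^ 3 := by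
  classical
  have hpR : ∀ p ∈ W, ‖p‖ ≤ R := fun p hp => by
    have h1 := hWR p hp
    have h2 : 0 ≤ Metric.infDist p (S \ (↑W : Set (EuclideanSpace ℝ (Fin 3)))) :=
      Metric.infDist_nonneg
    linarith
  have hinj : Set.InjOn π ↑W := fun p hp q hq h =>
    wb_pi_inj hS hεδ hπ (hWS hp) (hWS hq) (hpR p hp) (hpR q hq) h
  have hcard : (W.image π).card = W.card := Finset.card_image_of_injOn hinj
  have hWpos : 0 < (W.image π).card := by
    rw [hcard]
    exact hWne.card_pos
  have hWc : 0 < (W.image π)ᶜ.card := by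
    rw [Finset.card_compl, Fintype.card_fin, hcard]
    omega
  have hcut := cut_lt hyg (W.image π) hWpos hWc
  rw [hcard, Finset.sum_image hinj, Finset.sum_image hinj] at hcut
  have hcross := Finset.sum_le_sum fun p hp =>
    wb_cross_ge hδ hsep hεδ hε hε4 hπ hfit hWS hp (hWR p hp)
  rw [Finset.sum_neg_distrib, ← Finset.mul_sum] at hcross
  linarith

end Matching

/-- **Separation passes to the hull.** If the ground states of a sequence `x` are `δ`-separated and
`S` is two-way `ε`-matched on `‖·‖ ≤ R` by translates of `x N`, frequently in `N`, for every `R`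
and `ε > 0`, then distinct points of `S` are at distance `≥ δ` (match `p ≠ q` at a scale below
`dist p q / 4` using one good `N`; the frequently-in-`N` form of
`le_dist_of_eventually_matched`). [folklore] -/
theorem wb_sep_of_hull : ∀ (δ : ℝ) (x : (N : ℕ) → (Fin N → EuclideanSpace ℝ (Fin 3))),
    (∀ N, IsGroundState lennardJones (x N)) →
    (∀ (N : ℕ) (y : Fin N → EuclideanSpace ℝ (Fin 3)), IsGroundState lennardJones y →
      ∀ i j, i ≠ j → δ ≤ dist (y i) (y j)) →
    ∀ S : Set (EuclideanSpace ℝ (Fin 3)),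
      (∀ R ε : ℝ, 0 < ε → ∃ᶠ N in atTop, ∃ t : EuclideanSpace ℝ (Fin 3),
        (∀ p ∈ S, ‖p‖ ≤ R → ∃ i : Fin N, dist (x N i + t) p ≤ ε) ∧
        (∀ i : Fin N, ‖x N i + t‖ ≤ R → ∃ p ∈ S, dist (x N i + t) p ≤ ε)) →
      ∀ p ∈ S, ∀ q ∈ S, p ≠ q → δ ≤ dist p q := by
  intro δ x hx hsepx S hhull p hp q hq hpq
  have hpq0 : 0 < dist p q := dist_pos.2 hpq
  refine le_of_forall_pos_lt_add fun η hη => ?_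
  set ε : ℝ := min (η / 4) (dist p q / 4) with hε
  have hε0 : 0 < ε := lt_min (by linarith) (by linarith)
  have hεη : ε ≤ η / 4 := min_le_left _ _
  have hεpq : ε ≤ dist p q / 4 := min_le_right _ _
  obtain ⟨N, t, hA, -⟩ := (hhull (max ‖p‖ ‖q‖) ε hε0).exists
  obtain ⟨i, hi⟩ := hA p hp (le_max_left _ _)
  obtain ⟨i', hi'⟩ := hA q hq (le_max_right _ _)
  by_cases hii' : i = i'
  · subst hii'
    have : dist p q ≤ 2 * ε :=
      calc dist p q ≤ dist (x N i + t) p + dist (x N i + t) q := dist_triangle_left _ _ _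
        _ ≤ ε + ε := add_le_add hi hi'
        _ = 2 * ε := by ring
    linarith
  · have h1 : δ ≤ dist (x N i + t) (x N i' + t) := by
      rw [dist_add_right]
      exact hsepx N (x N) (hx N) i i' hii'
    have hi'' : dist q (x N i' + t) ≤ ε := by rwa [dist_comm] at hi'
    have : dist (x N i + t) (x N i' + t) ≤ dist p q + 2 * ε :=
      calc dist (x N i + t) (x N i' + t) ≤ dist (x N i + t) p + dist p (x N i' + t) :=
            dist_triangle _ _ _
        _ ≤ dist (x N i + t) p + (dist p q + dist q (x N i' + t)) :=
            add_le_add le_rfl (dist_triangle _ _ _)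
        _ ≤ ε + (dist p q + ε) := add_le_add hi (add_le_add le_rfl hi'')
        _ = dist p q + 2 * ε := by ring
    linarith

end Summit.AtomisticToContinuum.Crystallization.Theorems.LayeredHull

end
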